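import Summits.QuantumFields.QCD.Theorems.QuarksAsStableActionStableActionBridgeAPDetTransferForm
import Summits.QuantumFields.QCD.Theorems.QuarksAsStableActionStableActionBridgeAPTraceFreePos
import Summits.QuantumFields.QCD.Theorems.QuarksAsStableActionStableActionBridgeFockLiftPosDef

/-!
# Stub `stub_staticSliceBound` of line `Sketch` (idea `free-tangent-landau-chessboard`) — auxiliary lemmas
(crux `Summit.QuantumFields.QCD.Theses.QuarksAsStableAction.WilsonQuarkStability`, item stmt-QuantumFields-9736,
route route-QuantumFields-QuarksAsStableAction)

The stub is the time-direction static slice bound `‖det D_W[V]‖^L ≤ ∏_s ‖det D_W[S⁰_s V]‖` for the `r = 1`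
Wilson–Dirac operator of a `U(3)` field `V` on `(ℤ/L)⁴`, obtained from Lüscher's transfer-matrix form
`det D_W[V] = (∏_t det E_t) · det (1 − ∏_{i<L} M_i W_i)` (`wilson_det_transfer_form`, p120730) by the Fock functor
`Γ = fockLift` and an abstract cyclic Hölder inequality.  This file collects the field-independent ingredients:

* `Γ` of list products, powers and unitaries (`fockLift_list_prod`, `fockLift_pow`, `fockLift_mem_unitaryGroup`);
* `det_one_sub_prod_pow_le`: from the cyclic Hölder / chessboard inequality `‖Tr ∏_{i<L} T_i u_i‖^L ≤ ∏_i Re Tr T_i^L`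
  (hypothesis, for positive definite `T_i` and unitary `u_i`) applied on Fock space to `T_i = Γ(M_i)`,
  `u_i = Γ(±W_i)` (sign `−` on the seam `i = L − 1`), using `Tr Γ(X) = det (1 + X)`:
  `‖det (1 − ∏_{i<L} M_i W_i)‖^L ≤ ∏_t Re det (1 + M_t^L)`;
* `norm_det_one_add_pow`: `‖det (1 + X^L)‖ = Re det (1 + X^L)` for `X > 0`;
* `prod_map_range_sign`: `∏_{i<L} X E_i = −X^L` when `E_i = 1` off the seam and `E_{L−1} = −1` (static transporters);
* `sign_unitary_comm`: `±1` is a unitary commuting with everything (chain-block inputs of a static field);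
* the literal slice matrices of `wilson_det_transfer_form` as functions of the field: the backward temporal hop is the
  adjoint of the forward one (`conjTranspose_hopInv`), the hops of a slice with constant temporal links `g` are the
  colour lifts of `ρ g^{±1}` (`hop_eq_of_apply_eq`, `hopInv_eq_of_apply_eq`, `colourLift_one`, `colourLift_neg_one`),
  and the slice operators `A_t`, `B_t` only depend on the spatial links of slice `t` (`sliceOp_congr`,
  `sliceMassHop_congr`) — stated with the exact `Matrix.of` literals of the tree so that they apply to the
  `let`-bound transfer data by definitional unfolding.

Pure theorem file (no definitions). References: [Luscher1977, pp. 283–292]; [Smit2023, §6.5].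
-/

namespace Summit.QuantumFields.QCD.Cruxes.WilsonQuarkStability.FreeTangentLandauChessboard

namespace StaticSliceBound

open Literature.MathematicalPhysics Literature.MathematicalPhysics.QuantumLattice
  Literature.MathematicalPhysics.QuantumFieldTheory
open Literature.Probability.LatticeModels (TorusSite)
open Matrix Complex
open scoped ComplexOrder
open Summit.QuantumFields.QCD.Cruxes.StableActionBridge.Sketch

/-! ### The Fock functor on products, powers and unitaries -/

/-- `Γ` of an ordered list product is the ordered product of the `Γ`'s (functoriality `Γ(XY) = Γ(X)Γ(Y)`,
`Γ(1) = 1`). -/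
theorem fockLift_list_prod {ι : Type*} [LinearOrder ι] [Fintype ι] (l : List (Matrix ι ι ℂ)) :
    fockLift l.prod = (l.map fockLift).prod := by
  induction l with
  | nil => rw [List.prod_nil, List.map_nil, List.prod_nil, FockLiftPosDef.fockLift_one]
  | cons g l ih => rw [List.prod_cons, FockLiftPosDef.fockLift_mul, ih, List.map_cons, List.prod_cons]

/-- `Γ(X ^ n) = Γ(X) ^ n`. -/
theorem fockLift_pow {ι : Type*} [LinearOrder ι] [Fintype ι] (X : Matrix ι ι ℂ) (n : ℕ) :
    fockLift (X ^ n) = fockLift X ^ n := by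
  induction n with
  | zero => rw [pow_zero, pow_zero, FockLiftPosDef.fockLift_one]
  | succ n ih => rw [pow_succ, pow_succ, FockLiftPosDef.fockLift_mul, ih]

/-- `Γ` of a unitary one-particle matrix is unitary on Fock space: `Γ(X) Γ(X)ᴴ = Γ(X Xᴴ) = Γ(1) = 1`. -/
theorem fockLift_mem_unitaryGroup {ι : Type*} [LinearOrder ι] [Fintype ι] {X : Matrix ι ι ℂ}
    (hX : X ∈ Matrix.unitaryGroup ι ℂ) : fockLift X ∈ Matrix.unitaryGroup (Finset ι) ℂ := by
  rw [Matrix.mem_unitaryGroup_iff, star_eq_conjTranspose, ← FockLiftPosDef.fockLift_conjTranspose,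
    ← FockLiftPosDef.fockLift_mul, ← star_eq_conjTranspose, Matrix.mem_unitaryGroup_iff.mp hX,
    FockLiftPosDef.fockLift_one]

/-! ### The abstract Hölder step on Fock space -/

/-- **From the cyclic Hölder inequality to the determinant bound.**  If
`‖Tr ∏_{i<L} T_i u_i‖^L ≤ ∏_i Re Tr T_i^L` for all positive definite `T_i` and unitary `u_i` (hypothesis `hH`),
then for positive definite `M_t` and unitary `W_t` on a finite index type `ι`,
`‖det (1 − ∏_{i<L} M_i W_i)‖^L ≤ ∏_t Re det (1 + M_t^L)`: apply `hH` on the Fock space `Finset ι → ℂ` to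
`T_t = Γ(M_t)` and `u_t = Γ(W̃_t)` with `W̃_t = W_t` off the seam and `W̃_{−1} = −W_{−1}`, so that
`∏ Γ(M_i)Γ(W̃_i) = Γ(−∏ M_i W_i)` and `Tr Γ(X) = det (1 + X)` (`trace_fockLift`). -/
theorem det_one_sub_prod_pow_le {ι : Type} [Fintype ι] [DecidableEq ι] {L : ℕ} [NeZero L]
    (hH : ∀ {k : Type} [Fintype k] [DecidableEq k] (T u : ZMod L → Matrix k k ℂ),
      (∀ i, (T i).PosDef) → (∀ i, u i ∈ Matrix.unitaryGroup k ℂ) →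
      ‖((List.range L).map fun i : ℕ => T (i : ZMod L) * u (i : ZMod L)).prod.trace‖ ^ L ≤
        ∏ i : ZMod L, ((T i) ^ L).trace.re)
    (M W : ZMod L → Matrix ι ι ℂ) (hM : ∀ t, (M t).PosDef) (hW : ∀ t, W t ∈ Matrix.unitaryGroup ι ℂ) :
    ‖(1 - ((List.range L).map fun i : ℕ => M (i : ZMod L) * W (i : ZMod L)).prod).det‖ ^ L ≤
      ∏ t : ZMod L, ((1 + M t ^ L).det).re := by
  -- a linear order on `ι` (to enumerate Fock states), with the ambient decidable equality
  letI lo : LinearOrder ι :=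
    { le := fun a b => Fintype.equivFin ι a ≤ Fintype.equivFin ι b
      le_refl := fun a => le_refl _
      le_trans := fun a b c => le_trans
      le_antisymm := fun a b h1 h2 => (Fintype.equivFin ι).injective (le_antisymm h1 h2)
      le_total := fun a b => le_total _ _
      toDecidableLE := fun a b => inferInstanceAs (Decidable (Fintype.equivFin ι a ≤ Fintype.equivFin ι b))
      toDecidableEq := inferInstance }
  -- the sign-flipped transporters
  set Wt : ZMod L → Matrix ι ι ℂ := fun t => if t = -1 then -W t else W t with hWt
  have hWt_mem : ∀ t, Wt t ∈ Matrix.unitaryGroup ι ℂ := fun t => by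
    by_cases ht : t = -1
    · simp only [hWt, if_pos ht]
      rw [Matrix.mem_unitaryGroup_iff, star_neg, neg_mul_neg]
      exact Matrix.mem_unitaryGroup_iff.mp (hW t)
    · simp only [hWt, if_neg ht]
      exact hW t
  have key := hH (fun t => fockLift (M t)) (fun t => fockLift (Wt t))
    (fun t => FockLiftPosDef.fockLift_posDef' (hM t)) (fun t => fockLift_mem_unitaryGroup (hWt_mem t))
  have hL : L - 1 + 1 = L := Nat.sub_one_add_one_eq_of_pos (NeZero.pos L)
  have hprod : ((List.range L).map fun i : ℕ => M (i : ZMod L) * Wt (i : ZMod L)).prod =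
      -((List.range L).map fun i : ℕ => M (i : ZMod L) * W (i : ZMod L)).prod := by
    refine APDetTransferForm.prod_map_range_eq_neg hL _ _ (fun i hi => ?_) ?_
    · show M (i : ZMod L) * Wt (i : ZMod L) = M (i : ZMod L) * W (i : ZMod L)
      simp only [hWt, if_neg (APDetTransferForm.natCast_ne_neg_one hL hi)]
    · show M ((L - 1 : ℕ) : ZMod L) * Wt ((L - 1 : ℕ) : ZMod L) =
        -(M ((L - 1 : ℕ) : ZMod L) * W ((L - 1 : ℕ) : ZMod L))
      simp only [hWt, if_pos (APDetTransferForm.natCast_eq_neg_one hL), mul_neg]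
  have hlhs : ((List.range L).map fun i : ℕ =>
        fockLift (M (i : ZMod L)) * fockLift (Wt (i : ZMod L))).prod.trace =
      (1 - ((List.range L).map fun i : ℕ => M (i : ZMod L) * W (i : ZMod L)).prod).det := by
    have : ((List.range L).map fun i : ℕ => fockLift (M (i : ZMod L)) * fockLift (Wt (i : ZMod L))) =
        ((List.range L).map fun i : ℕ => M (i : ZMod L) * Wt (i : ZMod L)).map fockLift := by
      rw [List.map_map]
      refine List.map_congr_left fun i _ => ?_
      simp only [Function.comp_apply, FockLiftPosDef.fockLift_mul]
    rw [this, ← fockLift_list_prod, FockLiftPosDef.trace_fockLift, hprod, ← sub_eq_add_neg]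
  have hrhs : ∀ t : ZMod L, ((fockLift (M t)) ^ L).trace.re = ((1 + M t ^ L).det).re := fun t => by
    rw [← fockLift_pow, FockLiftPosDef.trace_fockLift]
  simpa only [hlhs, hrhs] using key

/-- For a positive definite `X`, `det (1 + X ^ L)` is a positive real number, so its norm is its real part. -/
theorem norm_det_one_add_pow {n : Type*} [Fintype n] [DecidableEq n] {X : Matrix n n ℂ}
    (hX : X.PosDef) (L : ℕ) : ‖(1 + X ^ L).det‖ = ((1 + X ^ L).det).re := by
  have hpos : (1 + X ^ L).PosDef := Matrix.PosDef.one.add_posSemidef (hX.posSemidef.pow L)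
  have h := congrArg Complex.re (Complex.norm_of_nonneg' hpos.det_pos.le)
  rwa [Complex.ofReal_re] at h

/-! ### Static transporters: signs -/

/-- `±1` is unitary and central: the inputs of the chain-block lemma for a sign transporter. -/
theorem sign_unitary_comm {k : Type*} [Fintype k] [DecidableEq k] (E P : Matrix k k ℂ)
    (hE : E = 1 ∨ E = -1) : E ∈ Matrix.unitaryGroup k ℂ ∧ E * P = P * E := by
  rcases hE with rfl | rfl
  · exact ⟨one_mem _, by rw [Matrix.one_mul, Matrix.mul_one]⟩
  · refine ⟨Matrix.mem_unitaryGroup_iff.mpr ?_, by rw [neg_mul, mul_neg, Matrix.one_mul, Matrix.mul_one]⟩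
    rw [star_neg, star_one, neg_mul_neg, Matrix.one_mul]

/-- An ordered product `∏_{i<L} X E_i` with `E_i = 1` off the seam `i = −1` and `E_{−1} = −1` equals `−X^L`. -/
theorem prod_map_range_sign {R : Type*} [Ring R] {L : ℕ} [NeZero L] (X : R) (E : ZMod L → R)
    (h1 : ∀ t, t ≠ -1 → E t = 1) (h2 : ∀ t, t = -1 → E t = -1) :
    ((List.range L).map fun i : ℕ => X * E (i : ZMod L)).prod = -(X ^ L) := by
  have hL : L - 1 + 1 = L := Nat.sub_one_add_one_eq_of_pos (NeZero.pos L)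
  rw [← APTraceFreePos.prod_map_range_const L X]
  refine APDetTransferForm.prod_map_range_eq_neg hL _ _ (fun i hi => ?_) ?_
  · show X * E (i : ZMod L) = X
    rw [h1 _ (APDetTransferForm.natCast_ne_neg_one hL hi), mul_one]
  · show X * E ((L - 1 : ℕ) : ZMod L) = -X
    rw [h2 _ (APDetTransferForm.natCast_eq_neg_one hL), mul_neg, mul_one]

/-! ### The literal slice matrices of `wilson_det_transfer_form` as functions of the field -/

section Hops

variable {Nc L : ℕ} {G : Type*} [Group G] (ρ : G →* Matrix (Fin Nc) (Fin Nc) ℂ)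

/-- The backward temporal hop is the adjoint of the forward one for a unitary representation:
`(ρ(U(x,0)⁻¹) ⊗ 1_spin)ᴴ = ρ(U(x,0)) ⊗ 1_spin`. -/
theorem conjTranspose_hopInv (hρ : ∀ g, ρ g ∈ Matrix.unitaryGroup (Fin Nc) ℂ)
    (U : GaugeConfig 4 L G) (t : ZMod L) :
    (Matrix.of fun a b : TorusSite 3 L × Fin Nc × Fin 4 => if a.1 = b.1 ∧ a.2.2 = b.2.2 then
          ρ (U ((Fin.cons t a.1 : TorusSite 4 L), 0))⁻¹ a.2.1 b.2.1 else 0)ᴴ =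
      Matrix.of fun a b : TorusSite 3 L × Fin Nc × Fin 4 => if a.1 = b.1 ∧ a.2.2 = b.2.2 then
          ρ (U ((Fin.cons t a.1 : TorusSite 4 L), 0)) a.2.1 b.2.1 else 0 := by
  ext ⟨x, c, α⟩ ⟨y, e, β⟩
  simp only [Matrix.conjTranspose_apply, Matrix.of_apply]
  by_cases h : x = y ∧ α = β
  · obtain ⟨rfl, rfl⟩ := h
    rw [if_pos ⟨rfl, rfl⟩, if_pos ⟨rfl, rfl⟩, SliceMassHop.rep_inv_eq_conjTranspose ρ hρ,
      Matrix.conjTranspose_apply, star_star]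
  · rw [if_neg h, if_neg (fun h' => h ⟨h'.1.symm, h'.2.symm⟩), star_zero]

/-- The forward temporal hop of slice `t` only sees the temporal links of slice `t`: if they all equal `g`, it is
the colour lift of `ρ g`. -/
theorem hop_eq_of_apply_eq (U : GaugeConfig 4 L G) (t : ZMod L) (g : G)
    (hU : ∀ y : TorusSite 3 L, U ((Fin.cons t y : TorusSite 4 L), 0) = g) :
    (Matrix.of fun a b : TorusSite 3 L × Fin Nc × Fin 4 => if a.1 = b.1 ∧ a.2.2 = b.2.2 then
          ρ (U ((Fin.cons t a.1 : TorusSite 4 L), 0)) a.2.1 b.2.1 else 0) =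
      Matrix.of fun a b : TorusSite 3 L × Fin Nc × Fin 4 => if a.1 = b.1 ∧ a.2.2 = b.2.2 then
          ρ g a.2.1 b.2.1 else 0 := by
  simp only [hU]

/-- The backward temporal hop of slice `t` with constant temporal links `g` is the colour lift of `ρ g⁻¹`. -/
theorem hopInv_eq_of_apply_eq (U : GaugeConfig 4 L G) (t : ZMod L) (g : G)
    (hU : ∀ y : TorusSite 3 L, U ((Fin.cons t y : TorusSite 4 L), 0) = g) :
    (Matrix.of fun a b : TorusSite 3 L × Fin Nc × Fin 4 => if a.1 = b.1 ∧ a.2.2 = b.2.2 then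
          ρ (U ((Fin.cons t a.1 : TorusSite 4 L), 0))⁻¹ a.2.1 b.2.1 else 0) =
      Matrix.of fun a b : TorusSite 3 L × Fin Nc × Fin 4 => if a.1 = b.1 ∧ a.2.2 = b.2.2 then
          ρ g⁻¹ a.2.1 b.2.1 else 0 := by
  simp only [hU]

/-- The colour lift of the identity is the identity. -/
theorem colourLift_one (X : Type*) [DecidableEq X] (N : ℕ) :
    (Matrix.of fun a b : X × Fin N × Fin 4 => if a.1 = b.1 ∧ a.2.2 = b.2.2 then
        (1 : Matrix (Fin N) (Fin N) ℂ) a.2.1 b.2.1 else 0) = 1 := by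
  ext ⟨x, c, α⟩ ⟨y, e, β⟩
  simp only [Matrix.of_apply, Matrix.one_apply, Prod.mk.injEq]
  by_cases hx : x = y <;> by_cases hc : c = e <;> by_cases hα : α = β <;> simp [hx, hc, hα]

/-- The colour lift of minus the identity is minus the identity. -/
theorem colourLift_neg_one (X : Type*) [DecidableEq X] (N : ℕ) :
    (Matrix.of fun a b : X × Fin N × Fin 4 => if a.1 = b.1 ∧ a.2.2 = b.2.2 then
        (-1 : Matrix (Fin N) (Fin N) ℂ) a.2.1 b.2.1 else 0) = -1 := by
  ext ⟨x, c, α⟩ ⟨y, e, β⟩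
  simp only [Matrix.of_apply, Matrix.neg_apply, Matrix.one_apply, Prod.mk.injEq]
  by_cases hx : x = y <;> by_cases hc : c = e <;> by_cases hα : α = β <;> simp [hx, hc, hα]

/-- The Wilson slice operator `A_t` of a field only depends on the spatial links of slice `t`: two fields/slices
with the same spatial links there have the same `A`. -/
theorem sliceOp_congr (U U' : GaugeConfig 4 L G) (m : ℝ) (t t' : ZMod L)
    (h : ∀ (y : TorusSite 3 L) (j : Fin 3),
      U ((Fin.cons t y : TorusSite 4 L), j.succ) = U' ((Fin.cons t' y : TorusSite 4 L), j.succ)) :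
    (Matrix.of fun a b : TorusSite 3 L × Fin Nc × Fin 4 =>
          (if a = b then ((m + 4 * 1 : ℝ) : ℂ) else 0) -
            (1 / 2 : ℂ) * ∑ j : Fin 3,
              ((if b.1 = Literature.MathematicalPhysics.QuantumFieldTheory.Site.shift a.1 j then
                  (((1 : ℝ) : ℂ) • (1 : Matrix (Fin 4) (Fin 4) ℂ) - euclideanGamma j.succ) a.2.2 b.2.2 *
                    ρ (U ((Fin.cons t a.1 : TorusSite 4 L), j.succ)) a.2.1 b.2.1 else 0) +
                (if a.1 = Literature.MathematicalPhysics.QuantumFieldTheory.Site.shift b.1 j then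
                  (((1 : ℝ) : ℂ) • (1 : Matrix (Fin 4) (Fin 4) ℂ) + euclideanGamma j.succ) a.2.2 b.2.2 *
                    ρ (U ((Fin.cons t b.1 : TorusSite 4 L), j.succ))⁻¹ a.2.1 b.2.1 else 0))) =
      Matrix.of fun a b : TorusSite 3 L × Fin Nc × Fin 4 =>
          (if a = b then ((m + 4 * 1 : ℝ) : ℂ) else 0) -
            (1 / 2 : ℂ) * ∑ j : Fin 3,
              ((if b.1 = Literature.MathematicalPhysics.QuantumFieldTheory.Site.shift a.1 j then
                  (((1 : ℝ) : ℂ) • (1 : Matrix (Fin 4) (Fin 4) ℂ) - euclideanGamma j.succ) a.2.2 b.2.2 *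
                    ρ (U' ((Fin.cons t' a.1 : TorusSite 4 L), j.succ)) a.2.1 b.2.1 else 0) +
                (if a.1 = Literature.MathematicalPhysics.QuantumFieldTheory.Site.shift b.1 j then
                  (((1 : ℝ) : ℂ) • (1 : Matrix (Fin 4) (Fin 4) ℂ) + euclideanGamma j.succ) a.2.2 b.2.2 *
                    ρ (U' ((Fin.cons t' b.1 : TorusSite 4 L), j.succ))⁻¹ a.2.1 b.2.1 else 0)) := by
  simp only [h]

/-- The spin-blind slice operator `B_t` of a field only depends on the spatial links of slice `t`. -/
theorem sliceMassHop_congr (U U' : GaugeConfig 4 L G) (m : ℝ) (t t' : ZMod L)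
    (h : ∀ (y : TorusSite 3 L) (j : Fin 3),
      U ((Fin.cons t y : TorusSite 4 L), j.succ) = U' ((Fin.cons t' y : TorusSite 4 L), j.succ)) :
    (Matrix.of fun a b : TorusSite 3 L × Fin Nc =>
          (if a = b then ((m + 4 : ℝ) : ℂ) else 0) -
            (1 / 2 : ℂ) * ∑ j : Fin 3,
              ((if b.1 = Literature.MathematicalPhysics.QuantumFieldTheory.Site.shift a.1 j then
                  ρ (U ((Fin.cons t a.1 : TorusSite 4 L), j.succ)) a.2 b.2 else 0) +
                (if a.1 = Literature.MathematicalPhysics.QuantumFieldTheory.Site.shift b.1 j then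
                  ρ (U ((Fin.cons t b.1 : TorusSite 4 L), j.succ))⁻¹ a.2 b.2 else 0))) =
      Matrix.of fun a b : TorusSite 3 L × Fin Nc =>
          (if a = b then ((m + 4 : ℝ) : ℂ) else 0) -
            (1 / 2 : ℂ) * ∑ j : Fin 3,
              ((if b.1 = Literature.MathematicalPhysics.QuantumFieldTheory.Site.shift a.1 j then
                  ρ (U' ((Fin.cons t' a.1 : TorusSite 4 L), j.succ)) a.2 b.2 else 0) +
                (if a.1 = Literature.MathematicalPhysics.QuantumFieldTheory.Site.shift b.1 j then
                  ρ (U' ((Fin.cons t' b.1 : TorusSite 4 L), j.succ))⁻¹ a.2 b.2 else 0)) := by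
  simp only [h]

end Hops

end StaticSliceBound

end Summit.QuantumFields.QCD.Cruxes.WilsonQuarkStability.FreeTangentLandauChessboard
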